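import Mathlib.Analysis.SpecialFunctions.Pow.Real
import Mathlib.Analysis.SpecialFunctions.Sqrt
import HarnessLib

/-!
# The face row `P3½` is stable under parallel composition at `{s,a,b,c}` (modulo the universal tropical law `(T)`)

Support file for crux `stmt-CriticalPhenomena-4575` (`NoHeavyLowerTail`), seat `prim-nh-lead-4575` lead gen 134 (`--supports stmt-CriticalPhenomena-4575`;
memo `run/shared/lean/prim/prim-nh-lead-4575/FROM-prim-nh-lead-4575-g134-V4-PARALLEL-CLOSURE.md`, §10).  No definitions, no sorries, standard axioms.
Companion of `…SuperTerminalQuarticStable` (the quartic row `V4`, modulo the sextic `(Q6)_c`); this file is logically independent and elementary.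

Setting (as in `…SuperTerminalQuarticOrdered`).  Two 4-terminal gadgets glued at `s, a, b, c`; cells of the 4-point partition law of a gadget: `n = P(s|a|b|c)`,
`σ = P(sa|b|c)`, `ζ = P(sa|cb)`, `β = P(cb|s|a)`, `ξs = P(sc|a|b)`, `ξa = P(ac|s|b)`, `τ = P(sac|b)`, `γ = P(c singleton)` (total mass `1`).  The reverse-Harris FACE ROW
`P3½ : μ(F)·μ(c↔T) ≤ 2·μ(F ∩ c↔T)` (`F = {s↔a}∩{s↮b}`, `T = {s,a,b}`; the face of `V4`, ⟹ TCB ⟹ TT-CHORD(E₃)) reads in cells `(σ+ζ+τ)(1−γ) ≤ 2(ζ+τ)`, i.e.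
`σ(1−γ) ≤ (ζ+τ)(1+γ)`.  The TROPICAL law `(T)`: `(n+σ)⁴ ≤ (n+σ+β+ζ)²(n+σ+ξs+ξa+τ)²γ` is `(Q4)_c` of the gadget with `s–a` glued — a THEOREM for every finite weighted graph
(`ThreePointIsoSexticAllGraphs.isoQuartic_graph`), multiplicative under gluing (`SuperTerminalQuarticOrdered.trop_mul`).  By the join rule
(`Literature.Probability.Percolation.PartitionLatticeGluing.real_partLE`) the composite has `Q = (n+σ)(n'+σ') − nn'`, `A = (n+σ+β+ζ)(n'+σ'+β'+ζ') − (n+β)(n'+β')`,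
`B = (n+σ+ξs+ξa+τ)(n'+σ'+ξs'+ξa'+τ') − (n+ξs)(n'+ξs') − (n+ξa)(n'+ξa') + nn'`, `γ∘ = γγ'`, and `μ(F∘) = A + B − Q`, `μ(F∘ ∩ c↔T) = A + B − 2Q`.

MAIN THEOREM (`p3half_stable`): **`[P3½ ∧ (T)](piece 1) ∧ [P3½ ∧ (T)](piece 2) ⟹ P3½(composite)`**; hence `P3½` on all finite weighted graphs reduces to `{s,a,b,c}`-prime graphs.
Proof (memo §10): with `u = γ^{1/4}`, `S = ζ+τ+β+ξs+ξa`, `g = ζ+τ`, `m = n+σ`: `(T)` and `4PR ≤ (P+R)² = (2m+S)²` give `2m(1−u) ≤ S·u`; `P3½` gives `σ(1−γ) ≤ g(1+γ)`;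
the composite's `μ(F∘ ∩ c↔T) ≥ σS' + σ'S + ng' + n'g`; and the three coefficient inequalities reduce to `coeff`:
`(1−xv⁴)(1+x)v ≤ ((1−x)v + 2(1−v)(1+x))(1+xv⁴)`, whose slack is `2(1−v)[(1−xv²)² + x(1−v)(1+v²)]`.
-/

namespace Summit.CriticalPhenomena.PercolationContinuityZ3.Theorems.SuperTerminalP3HalfStable

/-- The coefficient inequality: for `0 ≤ x`, `v ≤ 1`: `(1 − x v⁴)(1 + x)v ≤ ((1 − x)v + 2(1 − v)(1 + x))(1 + x v⁴)`
(slack `= 2(1−v)[(1−xv²)² + x(1−v)(1+v²)]`). [this work] -/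
theorem coeff {x v : ℝ} (hx : 0 ≤ x) (hv1 : v ≤ 1) :
    (1 - x * v ^ 4) * (1 + x) * v ≤ ((1 - x) * v + 2 * (1 - v) * (1 + x)) * (1 + x * v ^ 4) := by
  have e : ((1 - x) * v + 2 * (1 - v) * (1 + x)) * (1 + x * v ^ 4) - (1 - x * v ^ 4) * (1 + x) * v =
      2 * (1 - v) * ((1 - x * v ^ 2) ^ 2 + x * (1 - v) * (1 + v ^ 2)) := by ring
  have h : 0 ≤ 2 * (1 - v) * ((1 - x * v ^ 2) ^ 2 + x * (1 - v) * (1 + v ^ 2)) := by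
    have h1 : 0 ≤ 1 - v := by linarith
    positivity
  linarith

/-- **The reduced ten-variable inequality.**  Per piece `n, σ ≥ 0`, reals `g, S`, `0 < u ≤ 1` with `P3½`: `σ(1−u⁴) ≤ g(1+u⁴)` and the consequence of `(T)`:
`2(n+σ)(1−u) ≤ S·u`; then `(σσ' + σn' + nσ')(1 − u⁴u'⁴) ≤ (1 + u⁴u'⁴)(σS' + σ'S + ng' + n'g)`. [this work] -/
theorem core {n σ g S u n' σ' g' S' u' : ℝ}
    (hn : 0 ≤ n) (hσ : 0 ≤ σ) (hu0 : 0 < u) (hu1 : u ≤ 1)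
    (hP : σ * (1 - u ^ 4) ≤ g * (1 + u ^ 4)) (hT : 2 * (n + σ) * (1 - u) ≤ S * u)
    (hn' : 0 ≤ n') (hσ' : 0 ≤ σ') (hu0' : 0 < u') (hu1' : u' ≤ 1)
    (hP' : σ' * (1 - u' ^ 4) ≤ g' * (1 + u' ^ 4)) (hT' : 2 * (n' + σ') * (1 - u') ≤ S' * u') :
    (σ * σ' + σ * n' + n * σ') * (1 - u ^ 4 * u' ^ 4) ≤ (1 + u ^ 4 * u' ^ 4) * (σ * S' + σ' * S + n * g' + n' * g) := by
  -- abbreviations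
  have hx0 : 0 ≤ u ^ 4 := by positivity
  have hy0 : 0 ≤ u' ^ 4 := by positivity
  -- the three coefficient inequalities (cleared forms)
  -- C1 (coefficient of σ n'):  (1−xy)(1+x)u' ≤ ((1−x)u' + 2(1−u')(1+x))(1+xy)
  have C1 := coeff (x := u ^ 4) hx0 hu1'
  -- C3 (coefficient of n σ'):  (1−xy)(1+y)u ≤ ((1−y)u + 2(1−u)(1+y))(1+xy)
  have C3 := coeff (x := u' ^ 4) hy0 hu1
  -- ρ ≤ θ for each piece: (1−x)u ≤ 2(1−u)(1+x)  [coeff at x = 1]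
  have R1 := coeff (x := (1:ℝ)) zero_le_one hu1
  -- positivity of the denominators we multiply by
  -- rewrite everything as: LHS·(u u' (1+x)(1+y)) ≤ RHS·(u u' (1+x)(1+y)), then divide
  have key : (σ * σ' + σ * n' + n * σ') * (1 - u ^ 4 * u' ^ 4) * (u * u' * (1 + u ^ 4) * (1 + u' ^ 4)) ≤
      (1 + u ^ 4 * u' ^ 4) * (σ * S' + σ' * S + n * g' + n' * g) * (u * u' * (1 + u ^ 4) * (1 + u' ^ 4)) := by
    have hxy1 : 0 ≤ 1 + u ^ 4 * u' ^ 4 := by positivity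
    -- the four lower bounds, each multiplied by its nonnegative factor
    have t1 := mul_le_mul_of_nonneg_left hT' (show 0 ≤ σ * (u * (1 + u ^ 4) * (1 + u' ^ 4) * (1 + u ^ 4 * u' ^ 4)) by positivity)
    have t2 := mul_le_mul_of_nonneg_left hT (show 0 ≤ σ' * (u' * (1 + u ^ 4) * (1 + u' ^ 4) * (1 + u ^ 4 * u' ^ 4)) by positivity)
    have t3 := mul_le_mul_of_nonneg_left hP' (show 0 ≤ n * (u * u' * (1 + u ^ 4) * (1 + u ^ 4 * u' ^ 4)) by positivity)
    have t4 := mul_le_mul_of_nonneg_left hP (show 0 ≤ n' * (u * u' * (1 + u' ^ 4) * (1 + u ^ 4 * u' ^ 4)) by positivity)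
    -- coefficient inequalities times their nonnegative cell products
    have c1 := mul_le_mul_of_nonneg_left C1 (show 0 ≤ σ * n' * (u * (1 + u' ^ 4)) by positivity)
    have c3 := mul_le_mul_of_nonneg_left C3 (show 0 ≤ n * σ' * (u' * (1 + u ^ 4)) by positivity)
    have c2c := mul_le_mul_of_nonneg_left C1 (show 0 ≤ σ * σ' * (u * (1 + u' ^ 4)) by positivity)
    have c2a := mul_le_mul_of_nonneg_left R1 (show 0 ≤ σ * σ' * (u' * (1 + u ^ 4 * u' ^ 4) * (1 + u' ^ 4)) by positivity)
    linarith [t1, t2, t3, t4, c1, c3, c2c, c2a]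
  have hD : 0 < u * u' * (1 + u ^ 4) * (1 + u' ^ 4) := by positivity
  exact le_of_mul_le_mul_right key hD

/-- From the tropical law `(T)`: `m⁴ ≤ P²R²γ` with `P = m + p`, `R = m + r` (`p, r ≥ 0`), `u⁴ = γ`, `u ≥ 0` ⟹ `2m(1−u) ≤ (p+r)·u`
(because `4PR ≤ (P+R)² = (2m+p+r)²`). [this work] -/
theorem trop_root {m p r γ u : ℝ} (hm : 0 ≤ m) (hp : 0 ≤ p) (hr : 0 ≤ r) (hu : 0 ≤ u) (hγ : u ^ 4 = γ)
    (hT : m ^ 4 ≤ (m + p) ^ 2 * (m + r) ^ 2 * γ) : 2 * m * (1 - u) ≤ (p + r) * u := by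
  have h1 : (m + p) ^ 2 * (m + r) ^ 2 ≤ ((2 * m + p + r) / 2) ^ 4 := by
    have : (m + p) * (m + r) ≤ ((2 * m + p + r) / 2) ^ 2 := by nlinarith [sq_nonneg (p - r)]
    have h0 : 0 ≤ (m + p) * (m + r) := by positivity
    calc (m + p) ^ 2 * (m + r) ^ 2 = ((m + p) * (m + r)) ^ 2 := by ring
      _ ≤ (((2 * m + p + r) / 2) ^ 2) ^ 2 := pow_le_pow_left₀ h0 this 2
      _ = ((2 * m + p + r) / 2) ^ 4 := by ring
  have hγ0 : 0 ≤ γ := by rw [← hγ]; positivity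
  have h2 : m ^ 4 ≤ (((2 * m + p + r) / 2) * u) ^ 4 := by
    calc m ^ 4 ≤ (m + p) ^ 2 * (m + r) ^ 2 * γ := hT
      _ ≤ ((2 * m + p + r) / 2) ^ 4 * γ := mul_le_mul_of_nonneg_right h1 hγ0
      _ = (((2 * m + p + r) / 2) * u) ^ 4 := by rw [← hγ]; ring
  have h3 : m ≤ ((2 * m + p + r) / 2) * u := (pow_le_pow_iff_left₀ hm (by positivity) (by norm_num)).1 h2
  linarith

/-- **MAIN THEOREM: the face row `P3½` is stable under parallel composition at `{s,a,b,c}` modulo `(T)`.**  Piece 1 (cells unprimed) and piece 2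
(cells primed) both satisfy `P3½`: `(σ+ζ+τ)(1−γ) ≤ 2(ζ+τ)` and the tropical law `(T)`: `(n+σ)⁴ ≤ (n+σ+β+ζ)²(n+σ+ξs+ξa+τ)²γ` (a theorem for every finite weighted
graph), with `γ, γ' ≤ 1` (total mass one).  Then the composite cells `Q = (n+σ)(n'+σ') − nn'`, `A = (n+σ+β+ζ)(n'+σ'+β'+ζ') − (n+β)(n'+β')`,
`B = (n+σ+ξs+ξa+τ)(n'+σ'+ξs'+ξa'+τ') − (n+ξs)(n'+ξs') − (n+ξa)(n'+ξa') + nn'` (so `μ(F∘) = A + B − Q`, `μ(F∘ ∩ c↔T) = A + B − 2Q`) satisfy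
`(A + B − Q)(1 − γγ') ≤ 2(A + B − 2Q)`.  Hence `P3½` on all finite weighted graphs is equivalent to `P3½` on `{s,a,b,c}`-prime graphs. [this work] -/
theorem p3half_stable {n σ ζ β ξs ξa τ γ n' σ' ζ' β' ξs' ξa' τ' γ' : ℝ}
    (hn : 0 ≤ n) (hσ : 0 ≤ σ) (hζ : 0 ≤ ζ) (hβ : 0 ≤ β) (hξs : 0 ≤ ξs) (hξa : 0 ≤ ξa) (hτ : 0 ≤ τ) (hγ : 0 ≤ γ) (hγ1 : γ ≤ 1)
    (hn' : 0 ≤ n') (hσ' : 0 ≤ σ') (hζ' : 0 ≤ ζ') (hβ' : 0 ≤ β') (hξs' : 0 ≤ ξs') (hξa' : 0 ≤ ξa') (hτ' : 0 ≤ τ') (hγ' : 0 ≤ γ') (hγ1' : γ' ≤ 1)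
    (hP : (σ + ζ + τ) * (1 - γ) ≤ 2 * (ζ + τ))
    (hT : (n + σ) ^ 4 ≤ (n + σ + β + ζ) ^ 2 * (n + σ + ξs + ξa + τ) ^ 2 * γ)
    (hP' : (σ' + ζ' + τ') * (1 - γ') ≤ 2 * (ζ' + τ'))
    (hT' : (n' + σ') ^ 4 ≤ (n' + σ' + β' + ζ') ^ 2 * (n' + σ' + ξs' + ξa' + τ') ^ 2 * γ') :
    (((n + σ + β + ζ) * (n' + σ' + β' + ζ') - (n + β) * (n' + β')) +
      ((n + σ + ξs + ξa + τ) * (n' + σ' + ξs' + ξa' + τ') - (n + ξs) * (n' + ξs') - (n + ξa) * (n' + ξa') + n * n') -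
      ((n + σ) * (n' + σ') - n * n')) * (1 - γ * γ') ≤
    2 * (((n + σ + β + ζ) * (n' + σ' + β' + ζ') - (n + β) * (n' + β')) +
      ((n + σ + ξs + ξa + τ) * (n' + σ' + ξs' + ξa' + τ') - (n + ξs) * (n' + ξs') - (n + ξa) * (n' + ξa') + n * n') -
      2 * ((n + σ) * (n' + σ') - n * n')) := by
  -- names for the composite cells
  set Qc := (n + σ) * (n' + σ') - n * n' with hQc
  set Ac := (n + σ + β + ζ) * (n' + σ' + β' + ζ') - (n + β) * (n' + β') with hAc
  set Bc := (n + σ + ξs + ξa + τ) * (n' + σ' + ξs' + ξa' + τ') - (n + ξs) * (n' + ξs') - (n + ξa) * (n' + ξa') + n * n' with hBc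
  have eQ : Qc = σ * σ' + σ * n' + n * σ' := by rw [hQc]; ring
  have eζ : Ac - Qc = σ * ζ' + ζ * σ' + ζ * ζ' + σ * β' + ζ * n' + ζ * β' + n * ζ' + β * σ' + β * ζ' := by rw [hAc, hQc]; ring
  have eτ : Bc - Qc = σ * τ' + τ * σ' + τ * τ' + σ * (ξs' + ξa') + τ * n' + τ * (ξs' + ξa') + n * τ' + (ξs + ξa) * σ' +
      (ξs + ξa) * τ' + ξs * ξa' + ξa * ξs' := by rw [hBc, hQc]; ring
  have hQ0 : 0 ≤ Qc := by rw [eQ]; positivity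
  have hζc : 0 ≤ Ac - Qc := by rw [eζ]; positivity
  have hτc : 0 ≤ Bc - Qc := by rw [eτ]; positivity
  have hgg : 0 ≤ γ * γ' := mul_nonneg hγ hγ'
  -- the claim in the form `Qc(1−γγ') ≤ (Ac + Bc − 2Qc)(1+γγ')` (the same linear form)
  suffices H : Qc * (1 - γ * γ') ≤ (Ac + Bc - 2 * Qc) * (1 + γ * γ') by linarith only [H]
  -- degenerate ports: γ = 0 (or γ' = 0) forces n = σ = 0 (n' = σ' = 0) by (T), hence Qc = 0
  rcases eq_or_lt_of_le hγ with hγ0 | hγpos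
  · have h4 : (n + σ) ^ 4 ≤ 0 := by rw [← hγ0] at hT; simpa using hT
    have h0 : n + σ = 0 := (pow_eq_zero_iff (by norm_num)).1 (le_antisymm h4 (by positivity))
    have hn0 : n = 0 := by linarith only [h0, hn, hσ]
    have hs0 : σ = 0 := by linarith only [h0, hn, hσ]
    have hQz : Qc = 0 := by rw [eQ, hn0, hs0]; ring
    have hAB : 0 ≤ Ac + Bc := by linarith only [hζc, hτc, hQz]
    rw [hQz]
    nlinarith only [hAB, hgg]
  rcases eq_or_lt_of_le hγ' with hγ0' | hγpos'
  · have h4 : (n' + σ') ^ 4 ≤ 0 := by rw [← hγ0'] at hT'; simpa using hT'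
    have h0 : n' + σ' = 0 := (pow_eq_zero_iff (by norm_num)).1 (le_antisymm h4 (by positivity))
    have hn0 : n' = 0 := by linarith only [h0, hn', hσ']
    have hs0 : σ' = 0 := by linarith only [h0, hn', hσ']
    have hQz : Qc = 0 := by rw [eQ, hn0, hs0]; ring
    have hAB : 0 ≤ Ac + Bc := by linarith only [hζc, hτc, hQz]
    rw [hQz]
    nlinarith only [hAB, hgg]
  -- fourth roots
  obtain ⟨u, hu0, hu4⟩ : ∃ u : ℝ, 0 < u ∧ u ^ 4 = γ :=
    ⟨Real.sqrt (Real.sqrt γ), Real.sqrt_pos.2 (Real.sqrt_pos.2 hγpos), by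
      rw [show (4:ℕ) = 2 * 2 from rfl, pow_mul, Real.sq_sqrt (Real.sqrt_nonneg _), Real.sq_sqrt hγ]⟩
  obtain ⟨u', hu0', hu4'⟩ : ∃ u' : ℝ, 0 < u' ∧ u' ^ 4 = γ' :=
    ⟨Real.sqrt (Real.sqrt γ'), Real.sqrt_pos.2 (Real.sqrt_pos.2 hγpos'), by
      rw [show (4:ℕ) = 2 * 2 from rfl, pow_mul, Real.sq_sqrt (Real.sqrt_nonneg _), Real.sq_sqrt hγ']⟩
  have hu1 : u ≤ 1 := by
    by_contra h
    rw [not_le] at h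
    have : 1 < u ^ 4 := one_lt_pow₀ h (by norm_num)
    linarith only [this, hu4, hγ1]
  have hu1' : u' ≤ 1 := by
    by_contra h
    rw [not_le] at h
    have : 1 < u' ^ 4 := one_lt_pow₀ h (by norm_num)
    linarith only [this, hu4', hγ1']
  -- the reduced hypotheses
  have hT2 : (n + σ) ^ 4 ≤ ((n + σ) + (β + ζ)) ^ 2 * ((n + σ) + (ξs + ξa + τ)) ^ 2 * γ := by
    convert hT using 3 <;> ring
  have hT2' : (n' + σ') ^ 4 ≤ ((n' + σ') + (β' + ζ')) ^ 2 * ((n' + σ') + (ξs' + ξa' + τ')) ^ 2 * γ' := by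
    convert hT' using 3 <;> ring
  have hTr := trop_root (add_nonneg hn hσ) (add_nonneg hβ hζ) (by positivity) hu0.le hu4 hT2
  have hTr' := trop_root (add_nonneg hn' hσ') (add_nonneg hβ' hζ') (by positivity) hu0'.le hu4' hT2'
  have hPr : σ * (1 - u ^ 4) ≤ (ζ + τ) * (1 + u ^ 4) := by rw [hu4]; linarith only [hP]
  have hPr' : σ' * (1 - u' ^ 4) ≤ (ζ' + τ') * (1 + u' ^ 4) := by rw [hu4']; linarith only [hP']
  have C := core hn hσ hu0 hu1 hPr hTr hn' hσ' hu0' hu1' hPr' hTr'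
  rw [hu4, hu4'] at C
  -- `Ac + Bc − 2Qc = (σS' + σ'S + ng' + n'g) + X`, `X ≥ 0`
  have eAB : Ac + Bc - 2 * Qc =
      (σ * ((β' + ζ') + (ξs' + ξa' + τ')) + σ' * ((β + ζ) + (ξs + ξa + τ)) + n * (ζ' + τ') + n' * (ζ + τ)) +
      (ζ * ζ' + ζ * β' + β * ζ' + τ * τ' + τ * (ξs' + ξa') + (ξs + ξa) * τ' + ξs * ξa' + ξa * ξs') := by
    rw [hAc, hBc, hQc]; ring
  have hX : 0 ≤ ζ * ζ' + ζ * β' + β * ζ' + τ * τ' + τ * (ξs' + ξa') + (ξs + ξa) * τ' + ξs * ξa' + ξa * ξs' := by positivity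
  have hmid : (1 + γ * γ') * (σ * ((β' + ζ') + (ξs' + ξa' + τ')) + σ' * ((β + ζ) + (ξs + ξa + τ)) + n * (ζ' + τ') + n' * (ζ + τ))
      ≤ (1 + γ * γ') * (Ac + Bc - 2 * Qc) :=
    mul_le_mul_of_nonneg_left (by rw [eAB]; linarith only [hX]) (by positivity)
  rw [eQ]
  have eQ2 : (Ac + Bc - 2 * (σ * σ' + σ * n' + n * σ')) = Ac + Bc - 2 * Qc := by rw [eQ]
  rw [eQ2]
  linarith only [C, hmid]

/-- **Down-set form: the class of `P3½`-good D-vectors is closed under coordinatewise product.**  With the eight principal down-set probabilities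
`d0 = D(s|a|b|c)`, `d1 = D(sa|b|c)`, `d2 = D(sa|bc)`, `d3 = D(s|a|bc)`, `d4 = D(sac|b)`, `d5 = D(sc|a|b)`, `d6 = D(ac|s|b)`, `d7 = D(c|sab)` of a piece (they multiply under
gluing at `{s,a,b,c}`: `PartitionLatticeGluing.real_partLE`), the cells are `n = d0`, `σ = d1−d0`, `ζ = d2−d3−d1+d0`, `β = d3−d0`, `ξs = d5−d0`, `ξa = d6−d0`,
`τ = d4−d5−d6+d0−d1+d0`, `γ = d7`; `μ(F) = d2−d3+d4−d5−d6−d1+2d0`, `μ(F ∩ c↔T) = μ(F) − (d1−d0)`, `μ(c↔T) = 1−d7`.  If two vectors satisfy the order relations of a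
partition law, `d7 ≤ 1`, `P3½` and `(T)`: `d1⁴ ≤ d2²d4²d7`, then so does their product. [this work] -/
theorem dvec_p3half_mul {d0 d1 d2 d3 d4 d5 d6 d7 e0 e1 e2 e3 e4 e5 e6 e7 : ℝ}
    (h0 : 0 ≤ d0) (h1 : d0 ≤ d1) (h3 : d0 ≤ d3) (h5 : d0 ≤ d5) (h6 : d0 ≤ d6) (h7 : 0 ≤ d7) (h71 : d7 ≤ 1)
    (hζ : 0 ≤ d2 - d3 - d1 + d0) (hτ : 0 ≤ d4 - d5 - d6 + d0 - d1 + d0)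
    (hP : (d2 - d3 + d4 - d5 - d6 - d1 + 2 * d0) * (1 - d7) ≤ 2 * (d2 - d3 + d4 - d5 - d6 - 2 * d1 + 3 * d0))
    (hT : d1 ^ 4 ≤ d2 ^ 2 * d4 ^ 2 * d7)
    (g0 : 0 ≤ e0) (g1 : e0 ≤ e1) (g3 : e0 ≤ e3) (g5 : e0 ≤ e5) (g6 : e0 ≤ e6) (g7 : 0 ≤ e7) (g71 : e7 ≤ 1)
    (gζ : 0 ≤ e2 - e3 - e1 + e0) (gτ : 0 ≤ e4 - e5 - e6 + e0 - e1 + e0)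
    (gP : (e2 - e3 + e4 - e5 - e6 - e1 + 2 * e0) * (1 - e7) ≤ 2 * (e2 - e3 + e4 - e5 - e6 - 2 * e1 + 3 * e0))
    (gT : e1 ^ 4 ≤ e2 ^ 2 * e4 ^ 2 * e7) :
    (0 ≤ d0 * e0 ∧ d0 * e0 ≤ d1 * e1 ∧ d0 * e0 ≤ d3 * e3 ∧ d0 * e0 ≤ d5 * e5 ∧ d0 * e0 ≤ d6 * e6 ∧ 0 ≤ d7 * e7 ∧ d7 * e7 ≤ 1 ∧
      0 ≤ d2 * e2 - d3 * e3 - d1 * e1 + d0 * e0 ∧ 0 ≤ d4 * e4 - d5 * e5 - d6 * e6 + d0 * e0 - d1 * e1 + d0 * e0) ∧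
    (d2 * e2 - d3 * e3 + d4 * e4 - d5 * e5 - d6 * e6 - d1 * e1 + 2 * (d0 * e0)) * (1 - d7 * e7) ≤
      2 * (d2 * e2 - d3 * e3 + d4 * e4 - d5 * e5 - d6 * e6 - 2 * (d1 * e1) + 3 * (d0 * e0)) ∧
    (d1 * e1) ^ 4 ≤ (d2 * e2) ^ 2 * (d4 * e4) ^ 2 * (d7 * e7) := by
  have hd1 : 0 ≤ d1 := h0.trans h1
  have he1 : 0 ≤ e1 := g0.trans g1
  -- the main theorem in cells
  have T := p3half_stable (n := d0) (σ := d1 - d0) (ζ := d2 - d3 - d1 + d0) (β := d3 - d0) (ξs := d5 - d0) (ξa := d6 - d0)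
    (τ := d4 - d5 - d6 + d0 - d1 + d0) (γ := d7)
    (n' := e0) (σ' := e1 - e0) (ζ' := e2 - e3 - e1 + e0) (β' := e3 - e0) (ξs' := e5 - e0) (ξa' := e6 - e0)
    (τ' := e4 - e5 - e6 + e0 - e1 + e0) (γ' := e7)
    h0 (by linarith) hζ (by linarith) (by linarith) (by linarith) hτ h7 h71
    g0 (by linarith) gζ (by linarith) (by linarith) (by linarith) gτ g7 g71
    (by convert hP using 2 <;> ring) (by convert hT using 2 <;> ring) (by convert gP using 2 <;> ring) (by convert gT using 2 <;> ring)
  have TP : (d2 * e2 - d3 * e3 + d4 * e4 - d5 * e5 - d6 * e6 - d1 * e1 + 2 * (d0 * e0)) * (1 - d7 * e7) ≤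
      2 * (d2 * e2 - d3 * e3 + d4 * e4 - d5 * e5 - d6 * e6 - 2 * (d1 * e1) + 3 * (d0 * e0)) := by
    convert T using 2 <;> ring
  refine ⟨⟨by positivity, ?_, ?_, ?_, ?_, by positivity, ?_, ?_, ?_⟩, TP, ?_⟩
  · exact mul_le_mul h1 g1 g0 hd1
  · exact mul_le_mul h3 g3 g0 (h0.trans h3)
  · exact mul_le_mul h5 g5 g0 (h0.trans h5)
  · exact mul_le_mul h6 g6 g0 (h0.trans h6)
  · calc d7 * e7 ≤ 1 * 1 := mul_le_mul h71 g71 g7 zero_le_one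
      _ = 1 := by ring
  · -- `ζ∘ ≥ 0`: `d2e2 − d3e3 − d1e1 + d0e0 = (A∘ − Q∘)` with `A = d2 − d3 ≥ σ = d1 − d0 ≥ 0`, `U = d3 ≥ n = d0`
    have hA : d1 - d0 ≤ d2 - d3 := by linarith
    have gA : e1 - e0 ≤ e2 - e3 := by linarith
    have hQ : 0 ≤ d1 - d0 := by linarith
    have gQ : 0 ≤ e1 - e0 := by linarith
    have k1 := mul_le_mul hA gA gQ (hQ.trans hA)
    have k2 := mul_le_mul hA g3 g0 (hQ.trans hA)
    have k3 := mul_le_mul h3 gA gQ (h0.trans h3)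
    have e : d2 * e2 - d3 * e3 - d1 * e1 + d0 * e0 =
        ((d2 - d3) * (e2 - e3) - (d1 - d0) * (e1 - e0)) + ((d2 - d3) * e3 - (d1 - d0) * e0) + (d3 * (e2 - e3) - d0 * (e1 - e0)) := by ring
    rw [e]
    have s1 : 0 ≤ (d2 - d3) * (e2 - e3) - (d1 - d0) * (e1 - e0) := by linarith
    have s2 : 0 ≤ (d2 - d3) * e3 - (d1 - d0) * e0 := by linarith
    have s3 : 0 ≤ d3 * (e2 - e3) - d0 * (e1 - e0) := by linarith
    positivity
  · -- `τ∘ ≥ 0`: `B∘ − Q∘ ≥ (BB'+BW'+WB') − (σσ'+σn'+nσ') ≥ 0` with `B = d4−d5−d6+d0 ≥ σ`, `W = d5+d6−d0 ≥ n`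
    have hB : d1 - d0 ≤ d4 - d5 - d6 + d0 := by linarith
    have gB : e1 - e0 ≤ e4 - e5 - e6 + e0 := by linarith
    have hQ : 0 ≤ d1 - d0 := by linarith
    have gQ : 0 ≤ e1 - e0 := by linarith
    have hW : d0 ≤ d5 + d6 - d0 := by linarith
    have gW : e0 ≤ e5 + e6 - e0 := by linarith
    have k1 := mul_le_mul hB gB gQ (hQ.trans hB)
    have k2 := mul_le_mul hB gW g0 (hQ.trans hB)
    have k3 := mul_le_mul hW gB gQ (h0.trans hW)
    have x1 : 0 ≤ (d5 - d0) * (e6 - e0) := mul_nonneg (by linarith) (by linarith)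
    have x2 : 0 ≤ (d6 - d0) * (e5 - e0) := mul_nonneg (by linarith) (by linarith)
    have e : d4 * e4 - d5 * e5 - d6 * e6 + d0 * e0 - d1 * e1 + d0 * e0 =
        (((d4 - d5 - d6 + d0) * (e4 - e5 - e6 + e0) - (d1 - d0) * (e1 - e0)) + ((d4 - d5 - d6 + d0) * (e5 + e6 - e0) - (d1 - d0) * e0) +
        ((d5 + d6 - d0) * (e4 - e5 - e6 + e0) - d0 * (e1 - e0))) + ((d5 - d0) * (e6 - e0) + (d6 - d0) * (e5 - e0)) := by ring
    rw [e]
    have s1 : 0 ≤ (d4 - d5 - d6 + d0) * (e4 - e5 - e6 + e0) - (d1 - d0) * (e1 - e0) := by linarith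
    have s2 : 0 ≤ (d4 - d5 - d6 + d0) * (e5 + e6 - e0) - (d1 - d0) * e0 := by linarith
    have s3 : 0 ≤ (d5 + d6 - d0) * (e4 - e5 - e6 + e0) - d0 * (e1 - e0) := by linarith
    positivity
  · -- `(T)` is multiplicative
    have := mul_le_mul hT gT (by positivity) (le_trans (by positivity) hT)
    calc (d1 * e1) ^ 4 = d1 ^ 4 * e1 ^ 4 := by ring
      _ ≤ (d2 ^ 2 * d4 ^ 2 * d7) * (e2 ^ 2 * e4 ^ 2 * e7) := this
      _ = (d2 * e2) ^ 2 * (d4 * e4) ^ 2 * (d7 * e7) := by ring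

end Summit.CriticalPhenomena.PercolationContinuityZ3.Theorems.SuperTerminalP3HalfStable
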